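import Summits.ValiantsHypothesis.ValiantsHypothesis.Theorems.GrenetZeonDualUnipotentThreeHalvesHeavyTopBand
import Summits.ValiantsHypothesis.ValiantsHypothesis.Theorems.DualUnipotentThreeHalves.Negative.FlagCheapOfTriangularisable

/-!
# `GrenetZeon.DualUnipotentThreeHalves` (stmt-ValiantsHypothesis-24318) — line «radical_split» §8, instance table of R2:
# LEMMA D♯ (the sharp block count for triangularisable pencils) and THE `n = 4` COLUMN — `(4,6)` reduces to
# simultaneous triangularisability of the pencils with `≥ 12` independent tops

Second hand on the 24318 `HeavyTopLaw` INSTRUMENT (director-valiant g13 R259 (a); instrument pen val-port-3 g2; this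
file val-port-2 g2, val-lit merged desk b71 (B) port pool).  Vocabulary: `…WordDefs` (`HeavyTopInst`, `FlagCheap`,
`linPart`), `…WordFlagPencil` (`flagCheap_iff_wordTame`), `…HeavyTopBand` (tops nilpotent, Gerstenhaber bound, kernel
triviality, the quadratic band) and the Negative file `…Negative.FlagCheapOfTriangularisable` (✓ p615665, Lemma D).

* `card_sameBlock_pairs_le` — the EXACT count behind Lemma D: for the block levels `lvl i = (m−1−i)/h` the number of
  strictly upper pairs `(i,j)`, `i < j`, inside one block is `≤ m(h−1)/2` (two injections `(i, j−i−1)` and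
  `(j, h−1−(j−i))` into `Fin m × Fin (h−1)` with disjoint images), not only `≤ m(h−1)`.
* ★ `flagCheap_of_triangularisable_sharp` — **LEMMA D♯**: a simultaneously (strictly upper) triangularisable entrywise
  affine `m × m` pencil over `ℂ^{n×n}` is flag-cheap as soon as SOME block size `h ≥ 1` has
  `((m−1)/h + 1)·n + m(h−1)/2 < n²` — the levels take only `(m−1)/h + 1` values, so the budget is `(m−1)/h`
  (Lemma D used `m/h + 1` levels, budget `m/h`, and the pair bound `m(h−1)`).  Same `K` (tops vanishing inside the
  diagonal blocks), same constant flag; the proof is p615665's with the three counts replaced.  `FlagCheap` form: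
  `flagCheap_of_triangularisable_sharp'` (the line's definition, by `δ`).
* ★ `flagCheap_four_six_of_triangularisable` — INSTANCE `(n,m) = (4,6)`, `h = 2`: `3·4 + 3 = 15 < 16`: every
  simultaneously triangularisable affine `6 × 6` pencil over `ℂ^{4×4}` is `FlagCheap 4 6` (Lemma D's closed form needs
  `16m² ≤ n³` and its block form needs `(m/h+1)·n + m(h−1) < n²`, i.e. `22 < 16` at `h = 2` — both silent here).
* ★ `heavyTopInst_four_six_of_triangularisable_tops` — THE `(4,6)` ENTRY REDUCED: if every affine nilpotent `6 × 6`
  pencil over `ℂ^{4×4}` whose top space `N_lin(ℂ^{4×4})` has dimension `≥ 12` is simultaneously strictly upper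
  triangularisable by a constant matrix, then `HeavyTopInst 4 6` (pencils with `≤ 11` independent tops are flag-cheap by
  kernel triviality, `11 + 4 < 16`).  The top space is a LINEAR space of nilpotent matrices (`linPart_pow_eq_zero`) of
  dimension `12 … 15` inside `M₆(ℂ)` (`15 = dim 𝔫₆`, Gerstenhaber's equality case); whether such spaces — together with
  the constant term `N(0)` — triangularise simultaneously is a question for the structure theory of large nilpotent
  spaces (Gerstenhaber 1958; Mathes–Omladič–Radjavi, LAA 149 (1991); de Seguins Pazzis, LAA 438 (2013)), i.e. for
  WAVE-2's lens (a); it is NOT decided here.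
* ★★ `heavyTopInst_four_six_of_spaces_triangularisable` — THE SAME ENTRY FROM THE PRINT-SHAPED FACT «F(6,12)»: if every
  linear space of nilpotent `6 × 6` complex matrices of dimension `≥ 12` is simultaneously strictly-upper-triangularisable
  (Mathes–Omladič–Radjavi 1991 / de Seguins Pazzis 2013: dimension `> C(5,2) + 1 = 11`; not yet a tree fact — val-port-3 g2's
  literature ask «Q-near»), then `HeavyTopInst 4 6`; the bridge `triangularisable_pencil_of_spaces` passes from the
  linear span `ℂ·N(0) + tops` of the pencil to the polynomial matrix by `MvPolynomial.funext`.
* `heavyTopInst_four_of_le_five`, `format_four` — bookkeeping of the `n = 4` column for `C₀ = 1`: admissible `m ≤ 7`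
  (`49 < 64 ≤ 64`); `m ≤ 5` TRUE by the band (`C(5,2) + 4 = 14 < 16`, `C(6,2) + 4 = 19`); `m = 6` ⟸ the
  triangularisability statement above; `m = 7`: Lemma D♯ fails for every block size (`19, 19, 18, 25 ≥ 16` at
  `h = 2, 3, 4, 7`) and a `𝔫₇`-shaped top space has only `16 < 21` coordinates — the natural NEGATIVE candidate on the
  ✓ `not_heavyTopInst_three_five` template, open.

Honest framing.  Helper lemmas (`--supports stmt-ValiantsHypothesis-24318 --as helper`): instance-table rows of R2 at
ONE tiny format and a sharpened calibration lemma; R2 `HeavyTopLaw` (all admissible formats, uniform constants), S3b,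
the crux `DualUnipotentThreeHalves`, rung 8062 and `VP ≠ VNP` are untouched / NOT proved.
[this line's workfile `Cruxes/DualUnipotentThreeHalves/Lines/radical_split.lean` §8; ✓ p615665; Gerstenhaber 1958;
Mathes–Omladič–Radjavi 1991; de Seguins Pazzis 2013]
-/

-- `Summit.ValiantsHypothesis.ValiantsHypothesis.…` repeats a component (D-0017 layout); `dupNamespace` would flag the mandated name.
set_option linter.dupNamespace false
set_option autoImplicit false

noncomputable section

namespace Summit.ValiantsHypothesis.ValiantsHypothesis.Theorems.GrenetZeon.RadicalSplit

open MvPolynomial Matrix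
open scoped BigOperators
open Summit.ValiantsHypothesis.ValiantsHypothesis.Cruxes.TwoDimCoefficients.DimTwoCases (AffMat IsAffine)
open Summit.ValiantsHypothesis.ValiantsHypothesis.Theorems.DualUnipotentThreeHalvesNegative.FlagCost

/-! ## §1 The exact same-block pair count -/

/-- Arithmetic of one block: if `a < b < m` lie in the same block of the levels `(m−1−·)/h`, then the offset
`(m−1−a) % h` of `a` is at least `b − a`, and the offset of `b` plus `b − a` is still `< h`. -/
theorem sameBlock_offsets {m h a b : ℕ} (hh : 1 ≤ h) (hab : a < b) (hb : b < m)
    (he : (m - 1 - a) / h = (m - 1 - b) / h) :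
    b - a ≤ (m - 1 - a) % h ∧ (m - 1 - b) % h + (b - a) < h := by
  have ha' := Nat.div_add_mod (m - 1 - a) h
  have hb' := Nat.div_add_mod (m - 1 - b) h
  have hma := Nat.mod_lt (m - 1 - a) (by omega : 0 < h)
  have hmb := Nat.mod_lt (m - 1 - b) (by omega : 0 < h)
  rw [he] at ha'
  generalize h * ((m - 1 - b) / h) = t at ha' hb'
  omega

/-- **The exact pair count behind Lemma D.**  For the block levels `lvl i = (m−1−i)/h` (`h ≥ 1`) the strictly upper
pairs inside one block number at most `m(h−1)/2`: the maps `(i,j) ↦ (i, j−i−1)` and `(i,j) ↦ (j, h−1−(j−i))` are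
injections into `Fin m × Fin (h−1)` with disjoint images (the first lands in offsets `≥ t+1`, the second in offsets
`≤ t`). [this file] -/
theorem card_sameBlock_pairs_le (m h : ℕ) (hh : 1 ≤ h) (lvl : Fin m → ℕ)
    (hlvl : ∀ i, lvl i = (m - 1 - (i : ℕ)) / h) :
    Fintype.card {q : Fin m × Fin m // q.1 < q.2 ∧ lvl q.1 = lvl q.2} ≤ m * (h - 1) / 2 := by
  classical
  -- block arithmetic for a member of the subtype
  have key : ∀ q : {q : Fin m × Fin m // q.1 < q.2 ∧ lvl q.1 = lvl q.2},
      (q.1.1 : ℕ) < q.1.2 ∧ (q.1.2 : ℕ) < m ∧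
      (q.1.2 : ℕ) - q.1.1 ≤ (m - 1 - (q.1.1 : ℕ)) % h ∧ (m - 1 - (q.1.2 : ℕ)) % h + ((q.1.2 : ℕ) - q.1.1) < h := by
    rintro ⟨⟨i, j⟩, hij, he⟩
    have hij' : (i : ℕ) < j := hij
    have he' : (m - 1 - (i : ℕ)) / h = (m - 1 - (j : ℕ)) / h := by rw [← hlvl, ← hlvl]; exact he
    exact ⟨hij', j.isLt, sameBlock_offsets hh hij' j.isLt he'⟩
  let F : {q : Fin m × Fin m // q.1 < q.2 ∧ lvl q.1 = lvl q.2} ⊕ {q : Fin m × Fin m // q.1 < q.2 ∧ lvl q.1 = lvl q.2} →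
      Fin m × Fin (h - 1) := fun s =>
    match s with
    | Sum.inl q => (q.1.1, ⟨(q.1.2 : ℕ) - q.1.1 - 1, by
        obtain ⟨h1, -, h3, h4⟩ := key q
        have := Nat.mod_lt (m - 1 - (q.1.1 : ℕ)) (by omega : 0 < h)
        omega⟩)
    | Sum.inr q => (q.1.2, ⟨h - 1 - ((q.1.2 : ℕ) - q.1.1), by
        obtain ⟨h1, -, h3, h4⟩ := key q
        omega⟩)
  have hF : Function.Injective F := by
    rintro (q | q) (q' | q') hq
    · obtain ⟨h1, h2, h3, h4⟩ := key q
      obtain ⟨h1', h2', h3', h4'⟩ := key q'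
      simp only [F, Prod.mk.injEq, Fin.mk.injEq] at hq
      obtain ⟨hq1, hq2⟩ := hq
      have e1 : (q.1.1 : ℕ) = q'.1.1 := by rw [hq1]
      have e2 : q.1.2 = q'.1.2 := Fin.ext (by omega)
      exact congrArg Sum.inl (Subtype.ext (Prod.ext hq1 e2))
    · exfalso
      obtain ⟨h1, h2, h3, h4⟩ := key q
      obtain ⟨h1', h2', h3', h4'⟩ := key q'
      simp only [F, Prod.mk.injEq, Fin.mk.injEq] at hq
      obtain ⟨hq1, hq2⟩ := hq
      have e1 : (q.1.1 : ℕ) = q'.1.2 := by rw [hq1]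
      rw [e1] at h3
      omega
    · exfalso
      obtain ⟨h1, h2, h3, h4⟩ := key q
      obtain ⟨h1', h2', h3', h4'⟩ := key q'
      simp only [F, Prod.mk.injEq, Fin.mk.injEq] at hq
      obtain ⟨hq1, hq2⟩ := hq
      have e1 : (q.1.2 : ℕ) = q'.1.1 := by rw [hq1]
      rw [e1] at h4
      omega
    · obtain ⟨h1, h2, h3, h4⟩ := key q
      obtain ⟨h1', h2', h3', h4'⟩ := key q'
      simp only [F, Prod.mk.injEq, Fin.mk.injEq] at hq
      obtain ⟨hq1, hq2⟩ := hq
      have e1 : (q.1.2 : ℕ) = q'.1.2 := by rw [hq1]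
      have e2 : q.1.1 = q'.1.1 := Fin.ext (by omega)
      exact congrArg Sum.inr (Subtype.ext (Prod.ext e2 hq1))
  have hcard := Fintype.card_le_of_injective F hF
  rw [Fintype.card_sum, Fintype.card_prod, Fintype.card_fin, Fintype.card_fin] at hcard
  exact (Nat.le_div_iff_mul_le (by norm_num)).mpr (by omega)

/-! ## §2 Lemma D♯ — the sharp block form -/

/-- **Lemma D♯ (sharp block form).**  A simultaneously strictly-upper-triangularisable entrywise-affine pencil is
`FlagCheap n m N` (line `flag_cost` / `radical_split`, unfolded) as soon as some block size `h ≥ 1` satisfies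
`((m−1)/h + 1)·n + m(h−1)/2 < n²`: `K = {v : P N_lin(v) P⁻¹ vanishes inside the diagonal h-blocks}`,
`k = (m−1)/h`, and on every line the constant flag `g = P`, `lvl i = (m−1−i)/h`, `p = (m−1)/h + 1`, `r = a = 0`.
(Proof = ✓ p615665 `flagCheap_of_triangularisable_blocks` with the level count `(m−1)/h + 1`, the budget `(m−1)/h`
and the pair count `card_sameBlock_pairs_le`.) [this file; ✓ p615665] -/
theorem flagCheap_of_triangularisable_sharp {n m : ℕ}
    (N : Matrix (Fin m) (Fin m) (MvPolynomial (Fin n × Fin n) ℂ))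
    (hN : ∀ i j, (N i j).totalDegree ≤ 1)
    (P : (Matrix (Fin m) (Fin m) ℂ)ˣ)
    (htri : ∀ i j : Fin m, j ≤ i →
      ((P : Matrix (Fin m) (Fin m) ℂ).map C * N * (↑P⁻¹ : Matrix (Fin m) (Fin m) ℂ).map C :
        Matrix (Fin m) (Fin m) (MvPolynomial (Fin n × Fin n) ℂ)) i j = 0)
    (h : ℕ) (hh : 1 ≤ h) (hbudget : ((m - 1) / h + 1) * n + m * (h - 1) / 2 < n ^ 2) :
    ∃ (K : Submodule ℂ (Fin n × Fin n → ℂ)) (k : ℕ),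
      (∀ x v : Fin n × Fin n → ℂ, v ∈ K →
        ∃ (g : (Matrix (Fin m) (Fin m) ℂ)ˣ) (lvl : Fin m → ℕ) (p r a : ℕ),
          (∀ i, lvl i < p) ∧ (p - 1 + r * (n - 1)) / (a + 1) ≤ k ∧
          ∀ (i j : Fin m) (d : Fin 1 →₀ ℕ),
            coeff d (((g : Matrix (Fin m) (Fin m) ℂ).map C *
              N.map (aeval fun c => (C (x c) + ∑ t : Fin 1, C (v c) * X t : MvPolynomial (Fin 1) ℂ)) *
              (↑g⁻¹ : Matrix (Fin m) (Fin m) ℂ).map C : Matrix (Fin m) (Fin m) (MvPolynomial (Fin 1) ℂ)) i j) ≠ 0 →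
              (a + 1) * d 0 + lvl j ≤ lvl i + r) ∧
      (k + 1) * n < Module.finrank ℂ K := by
  classical
  -- block levels
  obtain ⟨lvl, hlvl⟩ : ∃ lvl : Fin m → ℕ, ∀ i, lvl i = (m - 1 - (i : ℕ)) / h := ⟨_, fun _ => rfl⟩
  have hanti : ∀ i j : Fin m, i < j → lvl j ≤ lvl i := fun i j hij => by
    rw [hlvl, hlvl]; exact Nat.div_le_div_right (by omega)
  -- the conjugated linear part, as a linear map
  obtain ⟨f, hf⟩ : ∃ f : (Fin n × Fin n → ℂ) → Matrix (Fin m) (Fin m) ℂ, ∀ v,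
      f v = (P : Matrix (Fin m) (Fin m) ℂ) *
        Matrix.of (fun i j => ∑ c, v c * coeff (Finsupp.single c 1) (N i j)) * (↑P⁻¹ : Matrix (Fin m) (Fin m) ℂ) :=
    ⟨_, fun _ => rfl⟩
  have hflin : IsLinearMap ℂ f := by
    constructor
    · intro v w
      have e : (Matrix.of fun i j => ∑ c, (v + w) c * coeff (Finsupp.single c 1) (N i j)) =
          (Matrix.of fun i j => ∑ c, v c * coeff (Finsupp.single c 1) (N i j)) +
          Matrix.of fun i j => ∑ c, w c * coeff (Finsupp.single c 1) (N i j) := by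
        ext i j; simp [Matrix.add_apply, add_mul, Finset.sum_add_distrib]
      rw [hf, hf, hf, e, Matrix.mul_add, Matrix.add_mul]
    · intro a v
      have e : (Matrix.of fun i j => ∑ c, (a • v) c * coeff (Finsupp.single c 1) (N i j)) =
          a • Matrix.of fun i j => ∑ c, v c * coeff (Finsupp.single c 1) (N i j) := by
        ext i j; simp [Matrix.smul_apply, Finset.mul_sum, mul_assoc]
      rw [hf, hf, e, Matrix.mul_smul, Matrix.smul_mul]
  obtain ⟨T, hT⟩ : ∃ T : (Fin n × Fin n → ℂ) →ₗ[ℂ] Matrix (Fin m) (Fin m) ℂ, ∀ v,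
      T v = (P : Matrix (Fin m) (Fin m) ℂ) *
        Matrix.of (fun i j => ∑ c, v c * coeff (Finsupp.single c 1) (N i j)) * (↑P⁻¹ : Matrix (Fin m) (Fin m) ℂ) :=
    ⟨IsLinearMap.mk' f hflin, fun v => by rw [IsLinearMap.mk'_apply, hf]⟩
  -- the within-block entries of the conjugated linear part, as a linear map to coordinates
  obtain ⟨l, hl⟩ : ∃ l : (Fin n × Fin n → ℂ) → ({q : Fin m × Fin m // q.1 < q.2 ∧ lvl q.1 = lvl q.2} → ℂ),
      ∀ v q, l v q = T v q.1.1 q.1.2 := ⟨fun v q => T v q.1.1 q.1.2, fun _ _ => rfl⟩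
  have hllin : IsLinearMap ℂ l := by
    constructor
    · intro v w; funext q; rw [Pi.add_apply, hl, hl, hl, map_add, Matrix.add_apply]
    · intro a v; funext q; rw [Pi.smul_apply, hl, hl, map_smul, Matrix.smul_apply, smul_eq_mul]
  obtain ⟨L, hL⟩ : ∃ L : (Fin n × Fin n → ℂ) →ₗ[ℂ]
      ({q : Fin m × Fin m // q.1 < q.2 ∧ lvl q.1 = lvl q.2} → ℂ), ∀ v q, L v q = T v q.1.1 q.1.2 :=
    ⟨IsLinearMap.mk' l hllin, fun v q => by rw [IsLinearMap.mk'_apply, hl]⟩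
  -- counting the within-block pairs EXACTLY
  have hcard : Fintype.card {q : Fin m × Fin m // q.1 < q.2 ∧ lvl q.1 = lvl q.2} ≤ m * (h - 1) / 2 :=
    card_sameBlock_pairs_le m h hh lvl hlvl
  refine ⟨LinearMap.ker L, (m - 1) / h, fun x v hv => ⟨P, lvl, (m - 1) / h + 1, 0, 0, fun i => ?_, ?_, ?_⟩, ?_⟩
  · -- levels are < p = (m-1)/h + 1
    rw [hlvl]; exact Nat.lt_succ_of_le (Nat.div_le_div_right (by omega))
  · -- the budget of the block flag is (m-1)/h
    simp only [Nat.add_sub_cancel, zero_mul, add_zero, zero_add, Nat.div_one, le_refl]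
  · -- adaptedness
    intro i j d hd
    set φ : MvPolynomial (Fin n × Fin n) ℂ →ₐ[ℂ] MvPolynomial (Fin 1) ℂ :=
      aeval fun c => (C (x c) + ∑ t : Fin 1, C (v c) * X t : MvPolynomial (Fin 1) ℂ) with hφ
    have hij : i < j := by
      rcases lt_or_ge i j with hlt' | hle
      · exact hlt'
      · exfalso
        apply hd
        rw [← map_conj_algHom φ, Matrix.map_apply, htri i j hle, map_zero, coeff_zero]
    have hcoeff := coeff_conj_apply (P : Matrix (Fin m) (Fin m) ℂ) (↑P⁻¹ : Matrix (Fin m) (Fin m) ℂ)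
      (N.map φ) d i j
    have hji := hanti i j hij
    rcases Nat.lt_or_ge (d 0) 2 with hlt | hge
    · rcases Nat.lt_or_ge (d 0) 1 with h0 | h1
      · have hd0 : d 0 = 0 := by omega
        rw [hd0, mul_zero, zero_add, add_zero]
        exact hji
      · have hd1 : d 0 = 1 := by omega
        have hdeq : d = Finsupp.single 0 1 := Finsupp.ext fun t => by
          fin_cases t; simp [hd1]
        have htop : coeff d (((P : Matrix (Fin m) (Fin m) ℂ).map C * N.map φ *
            (↑P⁻¹ : Matrix (Fin m) (Fin m) ℂ).map C : Matrix (Fin m) (Fin m) (MvPolynomial (Fin 1) ℂ)) i j) =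
            T v i j := by
          rw [hcoeff, hdeq, hφ, top_map_aeval_line_eq_linPart N hN x v, hT]
        have hne : lvl i ≠ lvl j := by
          intro he
          have h0 := congr_fun (LinearMap.mem_ker.mp hv) ⟨(i, j), hij, he⟩
          rw [hL, Pi.zero_apply] at h0
          exact hd (htop.trans h0)
        have hlt' : lvl j < lvl i := lt_of_le_of_ne hji (Ne.symm hne)
        rw [hd1]; omega
    · exfalso
      apply hd
      rw [hcoeff]
      have hz : (N.map φ).map (coeff d) = 0 := by
        ext a b
        simp only [Matrix.map_apply, Matrix.zero_apply]
        exact coeff_aeval_line_eq_zero_of_two_le _ (hN a b) x v d hge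
      rw [hz, Matrix.mul_zero, Matrix.zero_mul, Matrix.zero_apply]
  · -- dimension count: dim K ≥ n² − #pairs ≥ n² − m(h−1)/2 > ((m-1)/h + 1)·n
    have h1 := LinearMap.finrank_range_add_finrank_ker L
    have h2 : Module.finrank ℂ (LinearMap.range L) ≤
        Fintype.card {q : Fin m × Fin m // q.1 < q.2 ∧ lvl q.1 = lvl q.2} := by
      have := Submodule.finrank_le (LinearMap.range L)
      rwa [Module.finrank_fintype_fun_eq_card] at this
    have h3 : Module.finrank ℂ (Fin n × Fin n → ℂ) = n * n := by
      rw [Module.finrank_fintype_fun_eq_card, Fintype.card_prod, Fintype.card_fin]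
    have h4 : n ^ 2 = n * n := sq n
    omega

/-- **Lemma D♯ in the line's currency**: the same statement with the conclusion folded into `FlagCheap n m N`
(`…WordDefs`, definitionally the line's `FlagCheap`). [this file] -/
theorem flagCheap_of_triangularisable_sharp' {n m : ℕ} (N : AffMat n m) (hN : IsAffine N)
    (P : (Matrix (Fin m) (Fin m) ℂ)ˣ)
    (htri : ∀ i j : Fin m, j ≤ i →
      ((P : Matrix (Fin m) (Fin m) ℂ).map C * N * (↑P⁻¹ : Matrix (Fin m) (Fin m) ℂ).map C : AffMat n m) i j = 0)
    (h : ℕ) (hh : 1 ≤ h) (hbudget : ((m - 1) / h + 1) * n + m * (h - 1) / 2 < n ^ 2) :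
    FlagCheap n m N :=
  flagCheap_of_triangularisable_sharp N hN P htri h hh hbudget

/-! ## §3 The format `(n, m) = (4, 6)` -/

/-- ★ **`(4,6)`, triangularisable half.**  Every simultaneously strictly-upper-triangularisable affine `6 × 6` pencil
over `ℂ^{4×4}` is `FlagCheap 4 6`: block size `h = 2`, levels `(2,2,1,1,0,0)`, budget `2` (words with three tops
vanish on the `(2,2,2)` block flag), `dim K ≥ 16 − 3 = 13 > 3·4`. [this file] -/
theorem flagCheap_four_six_of_triangularisable (N : AffMat 4 6) (hN : IsAffine N)
    (P : (Matrix (Fin 6) (Fin 6) ℂ)ˣ)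
    (htri : ∀ i j : Fin 6, j ≤ i →
      ((P : Matrix (Fin 6) (Fin 6) ℂ).map C * N * (↑P⁻¹ : Matrix (Fin 6) (Fin 6) ℂ).map C : AffMat 4 6) i j = 0) :
    FlagCheap 4 6 N :=
  flagCheap_of_triangularisable_sharp' N hN P htri 2 (by norm_num) (by norm_num)

/-- ★ **THE `(4,6)` ENTRY OF THE INSTANCE TABLE, REDUCED.**  If every affine nilpotent `6 × 6` pencil over `ℂ^{4×4}`
with at least `12` linearly independent tops is simultaneously strictly-upper-triangularisable by a constant matrix,
then `HeavyTopInst 4 6` holds (the heavy-top hypothesis is not used): pencils with `≤ 11` independent tops are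
flag-cheap by kernel triviality (`11 + 4 < 16`, ✓ `flagCheap_of_finrank_range_lt`), the others by
`flagCheap_four_six_of_triangularisable`.  The top space is a linear space of NILPOTENT `6 × 6` matrices
(✓ `linPart_pow_eq_zero`) of dimension `12 … 15`. [this file] -/
theorem heavyTopInst_four_six_of_triangularisable_tops
    (H : ∀ N : AffMat 4 6, IsAffine N → N ^ 6 = 0 →
      ∀ T : (Fin 4 × Fin 4 → ℂ) →ₗ[ℂ] Matrix (Fin 6) (Fin 6) ℂ, (∀ v, T v = linPart N v) →
        12 ≤ Module.finrank ℂ (LinearMap.range T) →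
        ∃ P : (Matrix (Fin 6) (Fin 6) ℂ)ˣ, ∀ i j : Fin 6, j ≤ i →
          ((P : Matrix (Fin 6) (Fin 6) ℂ).map C * N * (↑P⁻¹ : Matrix (Fin 6) (Fin 6) ℂ).map C : AffMat 4 6) i j = 0) :
    HeavyTopInst 4 6 := by
  intro N hN hnil _
  obtain ⟨T, hT⟩ := exists_topMap_linPart N hN
  by_cases h11 : Module.finrank ℂ (LinearMap.range T) ≤ 11
  · exact flagCheap_of_finrank_range_lt N hN T hT (by omega)
  · obtain ⟨P, htri⟩ := H N hN hnil T hT (by omega)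
    exact flagCheap_four_six_of_triangularisable N hN P htri

/-- **From nilpotent SPACES to PENCILS.**  If every linear space of nilpotent `6 × 6` complex matrices of dimension
`≥ 12` is simultaneously strictly-upper-triangularisable by one invertible matrix («F(6,12)»; in print: spaces of dimension
`> C(5,2) + 1 = 11` — Mathes–Omladič–Radjavi 1991 / de Seguins Pazzis 2013, NOT yet a tree fact), then every affine
nilpotent `6 × 6` pencil over `ℂ^{4×4}` with `≥ 12` independent tops is triangularised as a POLYNOMIAL matrix: apply
F to `V′ = ℂ·N(0) + N_lin(ℂ^{4×4})` (`t·N(0) + N_lin(v) = t·N(v/t)` is nilpotent, tops are nilpotent), then an entry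
on or below the diagonal of `P·N·P⁻¹` vanishes at every point, hence is the zero polynomial. [this file] -/
theorem triangularisable_pencil_of_spaces
    (F : ∀ V : Submodule ℂ (Matrix (Fin 6) (Fin 6) ℂ), (∀ A ∈ V, A ^ 6 = 0) → 12 ≤ Module.finrank ℂ V →
      ∃ P : (Matrix (Fin 6) (Fin 6) ℂ)ˣ, ∀ A ∈ V, ∀ i j : Fin 6, j ≤ i →
        ((P : Matrix (Fin 6) (Fin 6) ℂ) * A * (↑P⁻¹ : Matrix (Fin 6) (Fin 6) ℂ)) i j = 0)
    (N : AffMat 4 6) (hN : IsAffine N) (hnil : N ^ 6 = 0)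
    (T : (Fin 4 × Fin 4 → ℂ) →ₗ[ℂ] Matrix (Fin 6) (Fin 6) ℂ) (hT : ∀ v, T v = linPart N v)
    (h12 : 12 ≤ Module.finrank ℂ (LinearMap.range T)) :
    ∃ P : (Matrix (Fin 6) (Fin 6) ℂ)ˣ, ∀ i j : Fin 6, j ≤ i →
      ((P : Matrix (Fin 6) (Fin 6) ℂ).map C * N * (↑P⁻¹ : Matrix (Fin 6) (Fin 6) ℂ).map C : AffMat 4 6) i j = 0 := by
  classical
  -- the linear span of the pencil: `V′ = ℂ·N(0) ⊔ tops`
  set V : Submodule ℂ (Matrix (Fin 6) (Fin 6) ℂ) := (ℂ ∙ N.map (MvPolynomial.eval 0)) ⊔ LinearMap.range T with hV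
  have heval : ∀ x : Fin 4 × Fin 4 → ℂ, N.map (MvPolynomial.eval x) = N.map (MvPolynomial.eval 0) + T x := by
    intro x; rw [hT]; unfold linPart; abel
  have hmemx : ∀ x : Fin 4 × Fin 4 → ℂ, N.map (MvPolynomial.eval x) ∈ V := by
    intro x; rw [heval]
    exact Submodule.add_mem_sup (Submodule.mem_span_singleton_self _) (LinearMap.mem_range_self T x)
  have hnilV : ∀ A ∈ V, A ^ 6 = 0 := by
    intro A hA
    rw [hV, Submodule.mem_sup] at hA
    obtain ⟨y, hy, z, hz, rfl⟩ := hA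
    obtain ⟨c, rfl⟩ := Submodule.mem_span_singleton.1 hy
    obtain ⟨v, rfl⟩ := LinearMap.mem_range.1 hz
    by_cases hc : c = 0
    · subst hc; rw [zero_smul, zero_add, hT]; exact linPart_pow_eq_zero N hN hnil v
    · have hA' : c • N.map (MvPolynomial.eval 0) + T v = c • N.map (MvPolynomial.eval (c⁻¹ • v)) := by
        rw [heval (c⁻¹ • v), smul_add, map_smul, smul_smul, mul_inv_cancel₀ hc, one_smul]
      rw [hA', smul_pow, map_eval_pow_eq_zero N hnil, smul_zero]
  have hdim : 12 ≤ Module.finrank ℂ V :=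
    h12.trans (Submodule.finrank_mono (le_sup_right : LinearMap.range T ≤ V))
  obtain ⟨P, hP⟩ := F V hnilV hdim
  refine ⟨P, fun i j hji => ?_⟩
  apply MvPolynomial.funext
  intro x
  have h1 : MvPolynomial.eval x (((P : Matrix (Fin 6) (Fin 6) ℂ).map C * N *
      (↑P⁻¹ : Matrix (Fin 6) (Fin 6) ℂ).map C : AffMat 4 6) i j) =
      ((P : Matrix (Fin 6) (Fin 6) ℂ) * N.map (MvPolynomial.eval x) * (↑P⁻¹ : Matrix (Fin 6) (Fin 6) ℂ)) i j := by
    have hPC : ((P : Matrix (Fin 6) (Fin 6) ℂ).map C).map (MvPolynomial.eval x) = (P : Matrix (Fin 6) (Fin 6) ℂ) := by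
      rw [Matrix.map_map]; ext a b; simp
    have hQC : ((↑P⁻¹ : Matrix (Fin 6) (Fin 6) ℂ).map C).map (MvPolynomial.eval x) = (↑P⁻¹ : Matrix (Fin 6) (Fin 6) ℂ) := by
      rw [Matrix.map_map]; ext a b; simp
    rw [← Matrix.map_apply (f := MvPolynomial.eval x), Matrix.map_mul, Matrix.map_mul, hPC, hQC]
  rw [h1, map_zero]
  exact hP _ (hmemx x) i j hji

/-- ★★ **THE `(4,6)` ENTRY ⟸ F(6,12).**  If every `≥ 12`-dimensional linear space of nilpotent `6 × 6` complex matrices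
is simultaneously strictly-upper-triangularisable (Mathes–Omladič–Radjavi 1991 / de Seguins Pazzis 2013 threshold
`C(5,2) + 1 = 11`, to be typed under `Literature/`), then `HeavyTopInst 4 6`. [this file] -/
theorem heavyTopInst_four_six_of_spaces_triangularisable
    (F : ∀ V : Submodule ℂ (Matrix (Fin 6) (Fin 6) ℂ), (∀ A ∈ V, A ^ 6 = 0) → 12 ≤ Module.finrank ℂ V →
      ∃ P : (Matrix (Fin 6) (Fin 6) ℂ)ˣ, ∀ A ∈ V, ∀ i j : Fin 6, j ≤ i →
        ((P : Matrix (Fin 6) (Fin 6) ℂ) * A * (↑P⁻¹ : Matrix (Fin 6) (Fin 6) ℂ)) i j = 0) :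
    HeavyTopInst 4 6 :=
  heavyTopInst_four_six_of_triangularisable_tops fun N hN hnil T hT h12 =>
    triangularisable_pencil_of_spaces F N hN hnil T hT h12

/-- The tops of a `(4,6)` pencil that escapes kernel triviality span a nilpotent linear space of dimension `12 … 15`
(`15 = dim 𝔫₆`): the exact range in which `heavyTopInst_four_six_of_triangularisable_tops` asks for triangularisability.
[this file; Gerstenhaber 1958 via ✓ `finrank_range_top_le_choose_two`] -/
theorem finrank_tops_four_six (N : AffMat 4 6) (hN : IsAffine N) (hnil : N ^ 6 = 0)
    (T : (Fin 4 × Fin 4 → ℂ) →ₗ[ℂ] Matrix (Fin 6) (Fin 6) ℂ) (hT : ∀ v, T v = linPart N v) :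
    Module.finrank ℂ (LinearMap.range T) ≤ 15 ∧ (∀ A ∈ LinearMap.range T, A ^ 6 = 0) ∧
      (Module.finrank ℂ (LinearMap.range T) ≤ 11 → FlagCheap 4 6 N) := by
  refine ⟨?_, fun A hA => ?_, fun h11 => flagCheap_of_finrank_range_lt N hN T hT (by omega)⟩
  · have := finrank_range_top_le_choose_two N hN hnil T hT
    have h15 : (6 : ℕ).choose 2 = 15 := by decide
    omega
  · obtain ⟨v, rfl⟩ := LinearMap.mem_range.1 hA
    rw [hT]; exact linPart_pow_eq_zero N hN hnil v

/-! ## §4 Bookkeeping: the `n = 4` column for `C₀ = 1` -/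

/-- `HeavyTopInst 4 m` for every `m ≤ 5` — the quadratic band (`C(m,2) + 4 < 16`). [✓ `heavyTopInst_of_choose_two_add_lt`] -/
theorem heavyTopInst_four_of_le_five {m : ℕ} (hm : m ≤ 5) : HeavyTopInst 4 m := by
  refine heavyTopInst_of_choose_two_add_lt ?_
  interval_cases m <;> decide

/-- The `n = 4` column of the instance table for `C₀ = 1`: the admissible formats are `m ≤ 7` (`m² < 64`); the band
covers `m ≤ 5` and stops at `m = 6` (`C(6,2) + 4 = 19 ≥ 16`); Lemma D♯'s count holds at `(4,6)` with `h = 2`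
(`15 < 16`) and FAILS at `(4,7)` for every block size `h ∈ {1,…,7}`. [bookkeeping, `decide`] -/
theorem format_four :
    (1 * 7 ^ 2 < 4 ^ 3 ∧ ¬ 1 * 8 ^ 2 < 4 ^ 3) ∧
    ((5 : ℕ).choose 2 + 4 < 4 * 4 ∧ ¬ (6 : ℕ).choose 2 + 4 < 4 * 4) ∧
    (((6 - 1) / 2 + 1) * 4 + 6 * (2 - 1) / 2 < 4 ^ 2) ∧
    (∀ h : Fin 8, 1 ≤ (h : ℕ) → ¬ ((7 - 1) / (h : ℕ) + 1) * 4 + 7 * ((h : ℕ) - 1) / 2 < 4 ^ 2) := by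
  refine ⟨by decide, by decide, by decide, by decide⟩

end Summit.ValiantsHypothesis.ValiantsHypothesis.Theorems.GrenetZeon.RadicalSplit
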